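import Summits.Ventures.PercRepro0.T2Twin
import Summits.Ventures.PercRepro0.ZhangSeparation
import Summits.Ventures.PercRepro0.ZhangSkel
import Summits.Ventures.PercRepro0.TrifCreate
import Summits.Ventures.PercRepro0.Sharpness

/-!
# T(2) closed: `θ_2(p_c(2)) = 0 ∧ p_c(2) = ½` with no hypothesis (seat p1, gen 2)

The planar leg of the cell's PARTIAL PROOF (2026-08-25T23:22:09Z), kernel-checked end to end on `Defs.lean`,
OFF the declaration path (evidence only; nothing is claimed beyond the declared paper proof):

* `T2Twin.T2_Planar_of_P1_P5` (p1): T2 · PLANAR-ASSEMBLY from P1 · HARRIS and P5 · SHARPNESS (p_c(2) = ½ via the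
  crossing bound `Separation` / `DualCrossing` and L1, θ_2(1) = 1, F2);
* `Zhang.P1_Harris_of` (p2): P1 · HARRIS `θ_2(½) = 0` from ZHANG SEPARATION and P3 · UNIQUE in `d = 2`;
* `ZhangSeparation.zhangSeparation_holds` (p1): ZHANG SEPARATION (P9 Lemma 4.1);
* `TrifCreate.P3_Unique_all` (p6): P3 · UNIQUE (Burton–Keane) in every dimension;
* `Sharp.P5_Sharpness_holds'` (p4): P5 · SHARPNESS in every dimension.

`T2_Planar_holds : T2_Planar` and `T_two_holds : T 2` — the brief's statement in dimension two, unconditional.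
-/

namespace Summit.Ventures.PercRepro0.PlanarClose

open Summit.Ventures.PercRepro0.Defs

/-- **T2 · PLANAR-ASSEMBLY, unconditional**: `θ_2(p_c(2)) = 0` and `p_c(2) = ½`
(T2-assembly-p4-v2 with every input kernel-checked: P1 via Zhang's argument and Burton–Keane, P5 via sharpness). -/
theorem T2_Planar_holds : T2_Planar :=
  Summit.Ventures.PercRepro0.T2Twin.T2_Planar_of_P1_P5
    (Summit.Ventures.PercRepro0.Zhang.P1_Harris_of
      Summit.Ventures.PercRepro0.ZhangSeparation.zhangSeparation_holds
      (Summit.Ventures.PercRepro0.TrifCreate.P3_Unique_all 2))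
    (Summit.Ventures.PercRepro0.Sharp.P5_Sharpness_holds' 2)

/-- **The brief in dimension two**: `T 2`, i.e. `θ_2(p_c(2)) = 0`, with no hypothesis. -/
theorem T_two_holds : T 2 := T2_Planar_holds.1

/-- `p_c(2) = ½` (Kesten), with no hypothesis. -/
theorem pc_two_eq_half : pc 2 = 1 / 2 := T2_Planar_holds.2

end Summit.Ventures.PercRepro0.PlanarClose
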